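import Summits.CriticalPhenomena.CardyFormulaZ2.Theses.CardyFlipRusso
import Literature.Analysis.FunctionSpaces.PoissonMecke
import Literature.Probability.RandomPlanarGeometry.ImageUnivalent

/-!
# Vocabulary of the line `moebius-exact-delaunay-dilation-ward` for the crux `VoronoiHubFromSmirnov`
# (stmt-CriticalPhenomena-6433, route `CardyFlipRusso`, sub-problem `CardyFormulaZ2`)

DEFINITIONS MODULE of the checked skeleton
`Cruxes/VoronoiHubFromSmirnov/Lines/moebius_exact_delaunay_dilation_ward.lean` (planner
`planner-cruxplan-stmt-CriticalPhenomena-6433-moebius-exact-delaun-0`, lead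
`prover-line-stmt-CriticalPhenomena-6433-a1-0`; `ledger skeleton check` registered the five stubs
`stub_measurableCrossEvent`, `stub_meckeRusso`, `stub_dilationWard`, `stub_conformalTransport`,
`stub_identification`).  It carries, sorry-free and VERBATIM from the skeleton, the line's vocabulary —
the crux's crossing event `crossEvent` (the set of the route decl
`Summit.CriticalPhenomena.CardyFormulaZ2.Theses.CardyFlipRusso.VoronoiHubFromSmirnov`, spelled out),
the Poisson law chooser `poissonLaw` / `lawBW`, the homogeneous and inhomogeneous annealed crossing
probabilities `homCrossProb` / `crossProb`, admissible intensity profiles and test weights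
(`AdmissibleDensity`, `TestWeight`, `densityPath`, `intensity`), one-nucleus insertion `insertAt` and
the annealed one-cell insertion response `insResp`, the two intermediate milestones `DensityBlind`,
`ConformalNull` — and the five stub STATEMENTS `Sig.stub_*` (each a `def … : Prop` to be PROVED by a
helper file `Theorems/CardyFlipRussoVoronoiHubFromSmirnov<Stub>.lean`, `--supports
stmt-CriticalPhenomena-6433`), so that the stub files and the closing skeleton share ONE copy of every
object.  Nothing in this file is asserted.

Sources: I. Benjamini, O. Schramm, *Conformal invariance of Voronoi percolation*, Comm. Math. Phys.
197 (1998) 75–107, Thm 2.1, Thm 5.6, §10 Conj. 10.1; G. Last, M. Penrose, *Lectures on the Poisson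
Process* (CUP 2017), Thm 4.1 (Mecke), Thm 19.1/19.3 (perturbation formula); B. Bollobás, O. Riordan,
*Percolation* (CUP 2006), Ch. 8 §8.1–8.2 (random Voronoi percolation, the black region and the
crossing event `H(R)`); F. Camia, C. M. Newman, Probab. Theory Related Fields 139 (2007) (SLE₆
identification).
-/

noncomputable section

namespace Summit.CriticalPhenomena.CardyFormulaZ2.Cruxes.VoronoiHubFromSmirnov.MoebiusExactDelaunayDilationWard

open scoped Topology ENNReal Interval
open Filter Set MeasureTheory
open Literature.Analysis.FunctionSpaces
open Literature.Probability.RandomPlanarGeometry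

/-! ### The crux's objects, named -/

/-- The crux's crossing event at mesh `δ` (verbatim the set of the route decl): pairs
`c = (black nuclei, white nuclei)` in CONFIGURATION coordinates (the physical nuclei are `δ • c`)
whose closed black region `{z | dist (z/δ, c.1) ≤ dist (z/δ, c.2)}` contains a continuum path
inside `closure Ω` from the arc `(ab) = R.arc 0` to the arc `(cd) = R.arc 2`. -/
def crossEvent (R : ConformalRectangle) (δ : ℝ) : Set (PointConfig ℂ × PointConfig ℂ) :=
  {c | ∃ x ∈ R.arc 0, ∃ y ∈ R.arc 2, JoinedIn (closure R.carrier ∩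
    {z | Metric.infDist (z / (δ : ℂ)) (c.1 : Set ℂ) ≤ Metric.infDist (z / (δ : ℂ)) (c.2 : Set ℂ)})
      x y}

/-- THE Poisson law with intensity `μ` (Kingman existence `existsUnique_isPoissonPointProcess_holds`
and Rényi uniqueness `IsPoissonPointProcess.unique_holds`, both PROVED in tree); a junk measure if no
Poisson process of intensity `μ` exists (never the case for the absolutely continuous locally finite
intensities below). -/
def poissonLaw (μ : Measure ℂ) : Measure (PointConfig ℂ) :=
  Classical.epsilon fun P : Measure (PointConfig ℂ) => IsPoissonPointProcess μ P

/-- Two INDEPENDENT Poisson processes of the same intensity `μ`: (black nuclei, white nuclei) —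
the annealed fair-coin Voronoi colouring. -/
def lawBW (μ : Measure ℂ) : Measure (PointConfig ℂ × PointConfig ℂ) :=
  (poissonLaw μ).prod (poissonLaw μ)

/-- The homogeneous annealed crossing probability of `R` at mesh `δ`: the crux's functional once its
universally quantified `PB`, `PW` are identified with `poissonLaw volume` by Rényi uniqueness
(`VoronoiHubFromSmirnov_of`). -/
def homCrossProb (R : ConformalRectangle) (δ : ℝ) : ℝ :=
  (lawBW volume).real (crossEvent R δ)

/-- Admissible intensity PROFILES `ρ : ℂ → ℝ` (physical coordinates): smooth, everywhere positive,
and equal to `1` outside a compact set (so that only a finite-mass part of the intensity is deformed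
and `log ρ` is a smooth compactly supported weight). -/
def AdmissibleDensity (ρ : ℂ → ℝ) : Prop :=
  ContDiff ℝ (⊤ : ℕ∞) ρ ∧ HasCompactSupport (fun x => ρ x - 1) ∧ ∀ x, 0 < ρ x

/-- Test weights for the Ward identity: smooth and compactly supported (physical coordinates). -/
def TestWeight (w : ℂ → ℝ) : Prop :=
  ContDiff ℝ (⊤ : ℕ∞) w ∧ HasCompactSupport w

/-- The linear density path `ρ_t = 1 + t (ρ − 1)` from the homogeneous profile (`t = 0`) to `ρ`
(`t = 1`); positive for `t ∈ [0,1]` when `ρ > 0`. Its `t`-derivative is the `t`-INDEPENDENT weight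
`ρ − 1`. -/
def densityPath (ρ : ℂ → ℝ) (t : ℝ) (x : ℂ) : ℝ :=
  1 + t * (ρ x - 1)

/-- The intensity measure of ONE colour at mesh `δ` along the path, in configuration coordinates:
density `ρ_t(δ z)` with respect to Lebesgue measure (push-forward by `z ↦ δ z` is the physical
intensity `δ⁻² ρ_t(w) dw`). At `t = 0` it is `volume` (`intensity_zero`). -/
def intensity (ρ : ℂ → ℝ) (t δ : ℝ) : Measure ℂ :=
  volume.withDensity fun z => ENNReal.ofReal (densityPath ρ t ((δ : ℂ) * z))

/-- The annealed crossing probability of `R` at mesh `δ` in the inhomogeneous model `ρ_t`. -/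
def crossProb (ρ : ℂ → ℝ) (t : ℝ) (R : ConformalRectangle) (δ : ℝ) : ℝ :=
  (lawBW (intensity ρ t δ)).real (crossEvent R δ)

/-- Insertion of one nucleus at `z` (configuration coordinates): `c ∪ {z}`, written with the tree's
`PointConfig.ofFn` as in the Mecke equation `multivariateMecke` (`m = 1`). -/
def insertAt (z : ℂ) (c : PointConfig ℂ) : PointConfig ℂ :=
  c ∪ PointConfig.ofFn ![z]

/-- **The annealed one-cell insertion response** at the configuration-coordinate point `z` in the
model `ρ_t` at mesh `δ`: `E[1_E(c₁ ∪ {z}, c₂) − 1_E(c)] + E[1_E(c₁, c₂ ∪ {z}) − 1_E(c)]` — the gain of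
the crossing event under insertion of a BLACK nucleus at `z` (≥ 0, the event is black-increasing)
plus its gain under insertion of a WHITE nucleus at `z` (≤ 0).  By colour flip ∘ self-duality of
cell colourings the first term is the white-insertion loss of the conjugate crossing `(bc) ↔ (da)`,
so `insResp` is the card's ARC-ROTATION-ODD field `Δ = π⁻_{E*} − π⁻_E`; triage r1-1's exact form:
`insResp(z) = P(A₄(N_z)) · (1 − 2 P(E | A₄(N_z)))` with `A₄(N_z)` = "the four boundary clusters of the
ORIGINAL configuration all meet the closed new cell" — (4-arm insertion pivotality) × (colour-odd
polarisation). -/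
def insResp (ρ : ℂ → ℝ) (t : ℝ) (R : ConformalRectangle) (δ : ℝ) (z : ℂ) : ℝ :=
  (lawBW (intensity ρ t δ)).real {c | (insertAt z c.1, c.2) ∈ crossEvent R δ}
    + (lawBW (intensity ρ t δ)).real {c | (c.1, insertAt z c.2) ∈ crossEvent R δ}
    - 2 * crossProb ρ t R δ

/-! ### Intermediate statements of the line (named, NOT stubs) -/

/-- DENSITY BLINDNESS (Benjamini–Schramm 1998, Density Invariance Conjecture 10.1, for the admissible
class): deforming the intensity profile from `1` to `ρ` changes the annealed crossing probability by
`o(1)` as `δ → 0⁺`.  Derived here from the Mecke identity and the Ward kernel (`densityBlind_of`). -/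
def DensityBlind : Prop :=
  ∀ ρ, AdmissibleDensity ρ → ∀ R : ConformalRectangle,
    Tendsto (fun δ => crossProb ρ 1 R δ - crossProb ρ 0 R δ) (𝓝[>] 0) (𝓝 0)

/-- ASYMPTOTIC CONFORMAL INVARIANCE of the homogeneous annealed crossing probabilities, transport
form: for `h` holomorphic and injective on an open neighbourhood `U` of `closure Ω`, the crossing
probabilities of `R` and of its image rectangle `h • R = R.imageUnivalent h …` (Beffara 2008 Def. 3)
at the same mesh differ by `o(1)`.  Derived here from density blindness and the conformal transport
(`conformalNull_of`); it is the hypothesis of the identification stub. -/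
def ConformalNull : Prop :=
  ∀ (R : ConformalRectangle) (h : ℂ → ℂ) (U : Set ℂ), IsOpen U →
    ∀ (hRU : closure R.carrier ⊆ U) (hd : DifferentiableOn ℂ h U) (hi : InjOn h U),
      Tendsto (fun δ => homCrossProb (R.imageUnivalent h (hd.mono hRU) (hi.mono hRU)) δ
        - homCrossProb R δ) (𝓝[>] 0) (𝓝 0)

/-! ### Stub signatures (`Sig.stub_X` is the statement of `stub_X`) -/

/-- S0 — MEASURABILITY OF THE CROSSING EVENT in the product of the count σ-algebras (plane
topology + Effros measurability of the random closed black region): `c ↦ (c.1 : Set ℂ)` is a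
measurable random closed set (`{c | c ∩ U ≠ ∅} = {N(U) ≥ 1}`), hence so is the black region
`{z | infDist (z/δ, c.1) ≤ infDist (z/δ, c.2)} ∩ closure Ω` (a compact set cut out by a Carathéodory
function); `closure Ω` is a closed topological disc (Schoenflies) and the black region near it a finite
union of convex polygons, so the components of their intersection are locally connected continua,
"joined by a path" = "in one component" is a closed condition under Hausdorff convergence, and the
event is a countable Boolean combination of hitting events.  Needed by the Mecke identity (S1) and the
Ward kernel (S2) — the crux's own `Measure.real` is an outer measure until this is proved. (folklore) -/
def Sig.stub_measurableCrossEvent : Prop :=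
  ∀ (R : ConformalRectangle) (δ : ℝ), 0 < δ → MeasurableSet (crossEvent R δ)

/-- S1 — THE MECKE–RUSSO IDENTITY (exact; Last–Penrose 2017 Thm 19.1 / 19.3 perturbation formula,
Mecke equation Thm 4.1 = `IsPoissonPointProcess.multivariateMecke_holds` at `m = 1`, superposition
for the fixed far part of the intensity; Molchanov–Zuyev 2000 first variation for signed
perturbations): along the linear density path the annealed crossing probability is absolutely
continuous in `t` with derivative the insertion response integrated against the `t`-independent
weight `ρ(δz) − 1`; stated, GIVEN measurability of the crossing event (S0), in integrated form on
`[0,1]` together with the integrability of the space integrand (compact support of `ρ − 1`,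
`|insResp| ≤ 2`, joint measurability of `(z, c) ↦ c ∪ {z}` — `PointConfig.measurable_union_holds`).
Signed perturbations `λ + t μ ≥ 0`: Last 2014 (arXiv:1203.6729) Thm 3.2; the fixed far part of the
intensity is an independent superposition and is conditioned on. (source: LastPenrose2017, Thm 19.1 and Thm 4.1) -/
def Sig.stub_meckeRusso : Prop :=
  ∀ ρ, AdmissibleDensity ρ → ∀ (R : ConformalRectangle) (δ : ℝ), 0 < δ →
    MeasurableSet (crossEvent R δ) →
    (∀ t ∈ Icc (0:ℝ) 1, Integrable fun z => (ρ ((δ : ℂ) * z) - 1) * insResp ρ t R δ z) ∧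
    crossProb ρ 1 R δ - crossProb ρ 0 R δ =
      ∫ t in (0:ℝ)..1, ∫ z, (ρ ((δ : ℂ) * z) - 1) * insResp ρ t R δ z

/-- S2 — THE KERNEL (W): THE LOCAL DILATION WARD IDENTITY (Benjamini–Schramm 1998, Density
Invariance Conjecture 10.1, differential Mecke form; OPEN — the line's bet).  In every admissible
inhomogeneous Poisson environment `ρ_t`, `t ∈ [0,1]`, the annealed insertion response integrates to
`o(1)` against every smooth compactly supported weight `w(δ z)`, uniformly in `t`:
`sup_{t ∈ [0,1]} |∫ w(δz) · insResp_{ρ_t,δ}(z) dz| → 0` as `δ → 0⁺`.  Scale: in configuration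
coordinates `Ω/δ` has area `≍ δ⁻²`, an insertion is pivotal with probability `≍ δ^{5/4}` (alternating
4-arm exponent), so each of the two terms of `insResp` integrates to `≍ δ^{-3/4}`; (W) asserts the
SIGNED, weighted integral is `o(1)` — cancellation beyond the marginal relative order `δ^{3/4}`.
`w ≡ const` near `closure Ω` is the pure DILATION Ward identity `λ ∂_λ P_λ → 0` (asymptotic scale
invariance — NOT supplied by any selection rule, triage r1-2); general `w` is its local form.  Stated
GIVEN measurability of the crossing events of `R` (S0) and WITH the integrability of the integrand, so
that the Bochner integral is never the junk value `0` (triage r1-1/r1-2 typing smell).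
Mechanism: leading ratio-limit term cancels (pivotal sets of `E` and `E*` are colour flips of each
other), spin-2 (stress-tensor) channel at relative order `δ^{3/4}` has zero Slivnyak–Palm mean by
isotropy (`stub_spinSelection`, landed), colour-odd scalar channels must have gap `> 3/4` (measured
`≈ 2.2` on 𝕋, kit j018089), colour-even scalars start at `x = 4`. (source: BenjaminiSchramm1998, §10 Conjecture 10.1 and Prop. 10.3) -/
def Sig.stub_dilationWard : Prop :=
  ∀ ρ, AdmissibleDensity ρ → ∀ w, TestWeight w → ∀ R : ConformalRectangle,
    (∀ δ : ℝ, 0 < δ → MeasurableSet (crossEvent R δ)) → ∀ ε > (0:ℝ),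
      ∀ᶠ δ : ℝ in 𝓝[>] 0, ∀ t ∈ Icc (0:ℝ) 1,
        Integrable (fun z => w ((δ : ℂ) * z) * insResp ρ t R δ z) ∧
          |∫ z, w ((δ : ℂ) * z) * insResp ρ t R δ z| ≤ ε

/-- S3 — CONFORMAL TRANSPORT (Benjamini–Schramm 1998 Thm 2.1 for Jordan conformal rectangles, via
Möbius-exact Delaunay adjacency): for `h` holomorphic and injective on an open `U ⊇ closure Ω` there
is an admissible profile `ρ`, equal to `|h′|²` on a neighbourhood of `closure Ω`, such that the
HOMOGENEOUS model on the image rectangle `h • R` and the model with profile `ρ` on `R` have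
asymptotically equal crossing probabilities at every mesh.  Proof plan: mapping theorem
(`mapHomeomorph'` on a disc exhausting `U`, restriction/superposition for the outside) pulls the
homogeneous nuclei on `h(U)` back to intensity `δ⁻²|h′|²` on `U`; the pulled-back cell structure is the
Voronoi tessellation for the `h`-metric, whose Delaunay graph differs from the Euclidean one of the
same nuclei only where a Delaunay quad's cocircularity defect is below `|Sh| · diam³` (any conformal
germ agrees with a Möbius germ to second order and Möbius maps preserve empty circumdiscs EXACTLY:
`SketchLine.stub_delaunayEdgeMoebius`, `isDelaunayPair_inversion_iff`; BS98 p. 80): `O(1)` such quads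
in expectation (Palm computation, = BS98 Thm 5.6 in `d = 2`), each pivotal with probability `≤ δ^c`
(Tassion's RSW / arm bound, uniform over comparable smooth intensities), plus an `O(δ)`-boundary layer
(cells meeting `∂Ω`, half-plane 3-arm) and the profile cut-off far from `closure Ω` (cells of
diameter `≫ δ` have super-exponentially small probability). (source: BenjaminiSchramm1998, Thm 2.1, Thm 5.6 and p. 80) -/
def Sig.stub_conformalTransport : Prop :=
  ∀ (R : ConformalRectangle) (h : ℂ → ℂ) (U : Set ℂ), IsOpen U →
    ∀ (hRU : closure R.carrier ⊆ U) (hd : DifferentiableOn ℂ h U) (hi : InjOn h U),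
      ∃ ρ, AdmissibleDensity ρ ∧
        (∃ V, IsOpen V ∧ closure R.carrier ⊆ V ∧ ∀ z ∈ V, ρ z = ‖deriv h z‖ ^ 2) ∧
        Tendsto (fun δ => homCrossProb (R.imageUnivalent h (hd.mono hRU) (hi.mono hRU)) δ
          - crossProb ρ 1 R δ) (𝓝[>] 0) (𝓝 0)

/-- S4 — IDENTIFICATION OF CONFORMALLY INVARIANT SUBSEQUENTIAL LIMITS (Schramm 2000; Lawler–Schramm–
Werner 2001 §3 locality ⇒ `κ = 6`; Camia–Newman 2007 §§5–7; Werner 2007 §3–4; for Voronoi: RSW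
Tassion 2016 Thm 1, quenched = annealed Ahlberg–Griffiths–Morris–Tassion 2016, annealed arm
separation Vanneuville 2019; exact domain Markov property of the Poisson exploration via stopping
sets): if the homogeneous annealed crossing probabilities are asymptotically conformally invariant
(`ConformalNull`), then for every conformal rectangle, every uniformizing datum `(φ, x)` and every
sequence of meshes `s_n → 0⁺` along which the crossing probability converges, the limit is
`cardyFunction (crossRatio x)`.  The Voronoi twin of `CardyUniqueLimit.CardyRigidity` (stmt-0746) /
`CardyViaSLE6.CovariantLimitIsSLE6` (stmt-14293), in subsequential form (no `LimitExists` is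
available: (W) carries no rate).  Exact Euclidean-motion and scaling covariance of `homCrossProb`
(mapping theorem with a similarity) are provable inputs, not hypotheses. (source: CamiaNewman2007, Thm 2–3; Schramm2000 §1.5; LawlerSchrammWerner2001 §3) -/
def Sig.stub_identification : Prop :=
  ConformalNull → ∀ (R : ConformalRectangle)
    (φ : ConformalEquiv UpperHalfPlane.upperHalfPlaneSet R.carrier) (x : Fin 4 → ℝ),
      R.IsUniformizing φ x → ∀ (s : ℕ → ℝ) (L : ℝ), Tendsto s atTop (𝓝[>] 0) →
        Tendsto (fun n => homCrossProb R (s n)) atTop (𝓝 L) → L = cardyFunction (crossRatio x)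

/-! ### Elementary glue (registered glue sub-goal of the line) -/

/-- At `t = 0` the density path is the homogeneous profile, so the intensity is Lebesgue measure
(for every profile `ρ` and every mesh `δ`). -/
theorem intensity_zero (ρ : ℂ → ℝ) (δ : ℝ) : intensity ρ 0 δ = volume := by
  unfold intensity densityPath
  simp only [zero_mul, add_zero, ENNReal.ofReal_one]
  exact withDensity_one

/-- Hence the `t = 0` crossing probability of the inhomogeneous model is the homogeneous annealed
crossing probability, for every profile (registered glue sub-goal; used by the skeleton's
`conformalNull_of`). -/
theorem crossProb_zero : ∀ (ρ : ℂ → ℝ) (R : ConformalRectangle) (δ : ℝ),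
    crossProb ρ 0 R δ = homCrossProb R δ := by
  intro ρ R δ
  unfold crossProb homCrossProb
  rw [intensity_zero]

/-! ### Reshaped stub statements (lead a1, cycle 1)

After wave 1 of the line (2026-08-16): S1 `stub_meckeRusso` is PROVED
(`Theorems/CardyFlipRussoVoronoiHubFromSmirnovStubMeckeRusso.lean`, p123634); S0
`stub_measurableCrossEvent` is reduced (`…StubMeasurableCrossEventReduction.lean`, p123590) to the
pure plane-topology statement `Sig.stub_joinedInConvexPieces` below; the integrability half of S2
`stub_dilationWard` is proved (`integrable_weight_mul_insResp`, `…StubMeckeRussoPrelims.lean`,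
p122876), leaving the Ward bound `Sig.stub_wardBound`.  The two new statements are registered stubs
of the reshaped skeleton; nothing is asserted here. -/

/-- S0′ — PATH-CONNECTEDNESS OF THE PIECES (pure plane topology; the residual content of S0 after
the landed reduction `stub_measurableCrossEvent_of_joinedIn_convexPieces`): for every Jordan domain
`Ω` and every finite family `𝒞` of closed convex sets with non-empty interior, any two points of a
connected subset of `closure Ω ∩ ⋃₀ 𝒞` are joined by a continuous path inside `closure Ω ∩ ⋃₀ 𝒞`
(components of a closed Jordan disc cut by finitely many convex bodies are path connected —
Torhorst / Moore–Menger type; `closure Ω` is the Carathéodory image of the closed disc,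
`JordanDomain.DiscChart`).  VERBATIM the hypothesis of the landed reduction theorem, so that
`stub_measurableCrossEvent_of_joinedIn_convexPieces : Sig.stub_joinedInConvexPieces →
Sig.stub_measurableCrossEvent` by `rfl` on the statement. -/
def Sig.stub_joinedInConvexPieces : Prop :=
  ∀ (Ω : JordanDomain) (𝒞 : Set (Set ℂ)), 𝒞.Finite →
    (∀ C ∈ 𝒞, IsClosed C ∧ Convex ℝ C ∧ (interior C).Nonempty) →
      ∀ S ⊆ closure Ω.carrier ∩ ⋃₀ 𝒞, IsPreconnected S →
        ∀ x ∈ S, ∀ y ∈ S, JoinedIn (closure Ω.carrier ∩ ⋃₀ 𝒞) x y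

/-- S2′ — THE WARD BOUND (the residual content of the kernel S2 once integrability is proved):
Benjamini–Schramm's Density-Invariance Conjecture 10.1 in differential (Ward) form — in every
admissible inhomogeneous Poisson environment `ρ_t`, `t ∈ [0,1]`, the annealed insertion response
integrates to at most `ε` against every smooth compactly supported weight `w(δ z)`, uniformly in
`t`, eventually as `δ → 0⁺`.  OPEN PROBLEM (Benjamini–Schramm 1998, §10 Conj. 10.1); the line's one
bet.  With `integrable_weight_mul_insResp` it gives `Sig.stub_dilationWard` (skeleton glue
`dilationWard_of`). -/
def Sig.stub_wardBound : Prop :=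
  ∀ ρ, AdmissibleDensity ρ → ∀ w, TestWeight w → ∀ R : ConformalRectangle,
    (∀ δ : ℝ, 0 < δ → MeasurableSet (crossEvent R δ)) → ∀ ε > (0:ℝ),
      ∀ᶠ δ : ℝ in 𝓝[>] 0, ∀ t ∈ Icc (0:ℝ) 1, |∫ z, w ((δ : ℂ) * z) * insResp ρ t R δ z| ≤ ε

/-! ### S0′ split for wave 2 (lead a1, cycle 2)

`Sig.stub_joinedInConvexPieces` (S0′) is glued in the skeleton (`joinedInConvexPieces_of`) from the
two registered stubs below: a GENERAL theorem of metric topology (a compact preconnected set which is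
connected im kleinen at each of its points is path connected — Moore 1916 / Mazurkiewicz 1920, the
"Peano continuum ⇒ arcwise connected" theorem, absent from Mathlib and the tree) and the GEOMETRIC
statement that every connected component of `closure Ω ∩ ⋃₀ 𝒞` is connected im kleinen at each of
its points.  Connectedness im kleinen is spelled out (it is `Literature.Topology.PlaneTopology.IsCIKAt`
of `Literature/Topology/PlaneTopology/ConnectedImKleinen.lean`, definitionally).  Nothing asserted. -/

/-- S0′a — PEANO CONTINUA ARE PATH CONNECTED (Moore 1916 / Mazurkiewicz 1920; Kuratowski II §50,
Whyburn 1942 I §12, Nadler 8.23): a compact preconnected subset `M` of the plane that is connected im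
kleinen at each of its points (`∀ ε > 0, ∃ δ > 0, M ∩ B(x, δ) ⊆` the component of `x` in `M ∩ B(x, ε)`,
i.e. `IsCIKAt M x`) has any two of its points joined by a continuous path inside `M`. -/
def Sig.stub_peanoPathConnected : Prop :=
  ∀ M : Set ℂ, IsCompact M → IsPreconnected M →
    (∀ x ∈ M, ∀ ε > (0:ℝ), ∃ δ > (0:ℝ),
      M ∩ Metric.ball x δ ⊆ connectedComponentIn (M ∩ Metric.ball x ε) x) →
    ∀ x ∈ M, ∀ y ∈ M, JoinedIn M x y

/-- S0′b — COMPONENTS OF A CLOSED JORDAN DISC CUT BY CONVEX BODIES ARE CONNECTED IM KLEINEN: for a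
Jordan domain `Ω` and a finite family `𝒞` of closed convex sets with non-empty interior, every connected
component `M` of `K = closure Ω ∩ ⋃₀ 𝒞` is connected im kleinen (as the set `M`) at each of its points.
Proof plan (lead): if not at `y ∈ M`, boundary bumping and the upper limit of components
(`exists_mem_connectedComponentIn_sphere`, `isPreconnected_seqLimsup`) give a non-degenerate
convergence continuum `N ∋ y` inside `M` approached by components `Q_k` of `M ∩ B̄(y, ε/2)` not meeting
the component of `y`; `K` is locally path connected at points of `Ω ∩ ⋃₀ 𝒞` (star-shaped) and of
`∂Ω ∩ interior (⋃₀ 𝒞)` (`exists_joinedIn_closure_ball`), so `N ⊆ ∂Ω ∩ ⋃ ∂C`; by Baire a sub-continuum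
lies on ONE convex curve `∂C_i`, inside the Jordan curve `∂Ω`; at a relative-interior point `m₀` of it,
`∂Ω` and `∂C_i` coincide near `m₀`, and a segment from an approaching point `q ∈ Q_k` (in `Ω`, inside
or outside `C_i`) to `m₀` stays in `K` — contradiction. -/
def Sig.stub_componentsCIK : Prop :=
  ∀ (Ω : JordanDomain) (𝒞 : Set (Set ℂ)), 𝒞.Finite →
    (∀ C ∈ 𝒞, IsClosed C ∧ Convex ℝ C ∧ (interior C).Nonempty) →
      ∀ x ∈ closure Ω.carrier ∩ ⋃₀ 𝒞, ∀ y ∈ connectedComponentIn (closure Ω.carrier ∩ ⋃₀ 𝒞) x,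
        ∀ ε > (0:ℝ), ∃ δ > (0:ℝ),
          connectedComponentIn (closure Ω.carrier ∩ ⋃₀ 𝒞) x ∩ Metric.ball y δ ⊆
            connectedComponentIn
              (connectedComponentIn (closure Ω.carrier ∩ ⋃₀ 𝒞) x ∩ Metric.ball y ε) y

/-! ### S3 split for lead c3 (2026-08-17): the transported tessellation

S3 (`Sig.stub_conformalTransport`) is glued in the skeleton (`conformalTransport_of`) from the two
registered stubs below, cut along the INTERMEDIATE EVENT `hCrossEvent R h V δ` = the crossing event
of `h • R` evaluated on the conformal images `h(δ b)/δ` of the nuclei `b` of the inhomogeneous model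
(profile `ρ = ‖h′‖²` on the bounded open `V ⊇ closure Ω`) with `δ b ∈ V`.  By Kingman's Mapping and
Restriction Theorems and Rényi uniqueness (PROVED in tree) these ARE homogeneous Poisson nuclei
restricted to `h(V)/δ`, and the crossing event of `h • R` ignores nuclei far from `closure (h Ω)`
with probability `1 − o(1)`: S3a, measure theory.  S3b compares, for the SAME nuclei, the Euclidean
Voronoi colouring of `closure Ω` with the colouring by the PULLED-BACK tessellation: Benjamini–
Schramm's theorem proper (§§4–9) plus the Jordan boundary layer.  Nothing is asserted here. -/

/-- The transport map in configuration coordinates at mesh `δ`: a nucleus `b` (physical position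
`δ b`) goes to `h (δ b) / δ`, the configuration coordinate of the image nucleus `h (δ b)`. -/
def transportMap (h : ℂ → ℂ) (δ : ℝ) (b : ℂ) : ℂ :=
  h ((δ : ℂ) * b) / (δ : ℂ)

/-- The transported nuclei of a configuration `c` at mesh `δ`: the images under `transportMap h δ`
of those nuclei whose physical position `δ b` lies in `V` (a finite set when `V` is bounded). -/
def transportSet (h : ℂ → ℂ) (V : Set ℂ) (δ : ℝ) (c : PointConfig ℂ) : Set ℂ :=
  transportMap h δ '' ((c : Set ℂ) ∩ {b | (δ : ℂ) * b ∈ V})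

/-- **The transported crossing event**: VERBATIM `crossEvent (h • R) δ` (arcs `h '' R.arc i`,
closed carrier `closure (h '' Ω)`) with the black / white nuclei replaced by the transported nuclei
`transportSet h V δ c.i`; pulled back by the homeomorphism `h : closure Ω → closure (h Ω)` it is the
continuum crossing of `closure Ω` inside the black region of the PULLED-BACK tessellation
`{z | min_b ‖h z − h (δ b)‖ ≤ min_w ‖h z − h (δ w)‖}` (nuclei with `δ b, δ w ∈ V`). -/
def hCrossEvent (R : ConformalRectangle) (h : ℂ → ℂ) (V : Set ℂ) (δ : ℝ) :
    Set (PointConfig ℂ × PointConfig ℂ) :=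
  {c | ∃ x ∈ h '' R.arc 0, ∃ y ∈ h '' R.arc 2, JoinedIn (closure (h '' R.carrier) ∩
    {w | Metric.infDist (w / (δ : ℂ)) (transportSet h V δ c.1) ≤
      Metric.infDist (w / (δ : ℂ)) (transportSet h V δ c.2)}) x y}

/-- S3a — TRANSPORT COUPLING (Kingman's Mapping + Restriction Theorems and Rényi uniqueness, all
PROVED in tree, plus locality of the crossing event with high probability): for `h` holomorphic and
injective on an open `U ⊇ closure Ω`, a bounded open `V` with `closure Ω ⊆ V`, `closure V ⊆ U`, and
an admissible profile `ρ = ‖h′‖²` on `V`, the HOMOGENEOUS annealed crossing probability of the image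
rectangle `h • R` and the probability of the transported crossing event `hCrossEvent R h V δ` under
the INHOMOGENEOUS model `ρ` differ by `o(1)` as `δ → 0⁺` (in fact only by the probability that a
cell meeting `closure (h Ω)` has its nucleus outside `h(V)`, a void-ball event).  The push-forward of
`Poisson(ρ(δ·) Leb)|_{V/δ}` under `b ↦ h(δ b)/δ` is `Poisson(Leb)|_{h(V)/δ}` because the real Jacobian
of a holomorphic map is `‖h′‖²`. (source: Kingman1993, §2.2 Restriction Theorem and §2.3 Mapping Theorem; BenjaminiSchramm1998, §3) -/
def Sig.stub_transportCoupling : Prop :=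
  ∀ (R : ConformalRectangle) (h : ℂ → ℂ) (U : Set ℂ), IsOpen U →
    ∀ (hRU : closure R.carrier ⊆ U) (hd : DifferentiableOn ℂ h U) (hi : InjOn h U),
    ∀ V : Set ℂ, IsOpen V → Bornology.IsBounded V → closure R.carrier ⊆ V → closure V ⊆ U →
    ∀ ρ, AdmissibleDensity ρ → (∀ z ∈ V, ρ z = ‖deriv h z‖ ^ 2) →
      Tendsto (fun δ => homCrossProb (R.imageUnivalent h (hd.mono hRU) (hi.mono hRU)) δ
        - (lawBW (intensity ρ 1 δ)).real (hCrossEvent R h V δ)) (𝓝[>] 0) (𝓝 0)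

/-- S3b — TRANSPORT HEART (Benjamini–Schramm 1998 Thm 2.1 proper, planar case, re-cut for Jordan
conformal rectangles): for the SAME inhomogeneous nuclei (profile `ρ = ‖h′‖²` on `V`), the continuum
crossing of `closure Ω` in the Euclidean Voronoi colouring and in the colouring by the pulled-back
tessellation (`hCrossEvent`, see above) have probabilities differing by `o(1)` as `δ → 0⁺`.  Content:
on the no-giant-cells event the two tessellations of the nuclei near `closure Ω` have the same
Delaunay adjacency except at local potential defects (BS98 Lemma 4.2 = landed
`defect_implies_potentialDefect`, Möbius-exactness of empty circumdiscs), of which there are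
`O(polylog δ⁻¹)` in expectation (BS98 Prop. 5.3; landed `poisson_navelTie_le`, `poisson_closePair_le`),
and the colouring is insensitive to recolouring their neighbourhoods (BS98 §§7–9, Lemma 8.1 = landed
`insensitivity_unionLaw`; FKG for Poisson functionals); plus a boundary layer of width `O(δ² polylog)`
along the Jordan arcs (cell boundaries move to first order), which BS98's cluster-based crossing event
avoids (p. 78) and which here needs a one-arm / boundary RSW estimate (Tassion 2016). OPEN in tree. (source: BenjaminiSchramm1998, Thm 2.1, §9) -/
def Sig.stub_transportHeart : Prop :=
  ∀ (R : ConformalRectangle) (h : ℂ → ℂ) (U : Set ℂ), IsOpen U →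
    closure R.carrier ⊆ U → DifferentiableOn ℂ h U → InjOn h U →
    ∀ V : Set ℂ, IsOpen V → Bornology.IsBounded V → closure R.carrier ⊆ V → closure V ⊆ U →
    ∀ ρ, AdmissibleDensity ρ → (∀ z ∈ V, ρ z = ‖deriv h z‖ ^ 2) →
      Tendsto (fun δ => (lawBW (intensity ρ 1 δ)).real (hCrossEvent R h V δ)
        - crossProb ρ 1 R δ) (𝓝[>] 0) (𝓝 0)

end Summit.CriticalPhenomena.CardyFormulaZ2.Cruxes.VoronoiHubFromSmirnov.MoebiusExactDelaunayDilationWard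

end
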